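import Literature.Geometry.Riemannian.WeightedHeatFlowCompleteEntropy
import Literature.Geometry.Riemannian.WeightedHeatSemigroupComplete
import Literature.Geometry.Riemannian.BakryEmeryLogSobolevReduction
import HarnessLib

/-!
# The Bakry–Émery logarithmic Sobolev inequality on a complete manifold from the heat semigroup

Final layer of the proof of the named fact `bakryEmery_logSobolev_complete` (`BakryEmeryLogSobolev.lean`;
Bakry–Émery 1985; Carrillo–Ni 2009, Thm. 3.1; Bakry–Gentil–Ledoux 2014, Prop. 5.7.1) from the heat
semigroup of the complete weighted manifold. Bakry–Gentil–Ledoux run the proof of Prop. 5.7.1 (p. 268)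
for `f ∈ 𝒜₀^{const+}` along `P_t f`: `d/dt Ent_μ(P_t f) = −I_μ(P_t f)`, `I_μ(P_t f) ≤ e^{-2ρt} I_μ(f)`
(from the strong gradient bound, Thm. 3.2.4, and the Cauchy–Schwarz inequality for `P_t`), and
`Ent_μ(P_t f) → 0`; here every step is proved on a complete non-compact manifold
(`WeightedGreenComplete.lean`, `MarkovOperatorBounds.lean`, `WeightedHeatFlowCompleteDecay.lean`,
`WeightedHeatFlowCompleteEntropy.lean`), GIVEN operators `P t` with the properties (i)–(iv) of the
named fact `weightedHeatSemigroup_strongGradientBound_complete` (`WeightedHeatSemigroupComplete.lean`):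

* `le_div_of_hasDerivAt_of_decay` — the one-variable step `H(0) ≤ I₀/2K` from `H' = −I`,
  `I ≤ e^{-2Kt}I₀`, `H → 0`;
* `logSobolev_eventuallyConst_of_semigroup` — **the inequality `∫ φ e^φ e^{-V} ≤ (2K)⁻¹ ∫ |∇φ|² e^φ e^{-V}`
  for smooth `φ` constant outside a compact set with `∫ e^φ e^{-V} = 1`**, on a complete connected
  manifold with `∫ e^{-V} dV_g = 1`, `K > 0`, from such operators `P t` — exactly the hypothesis `hcore`
  of `bakryEmery_logSobolev_complete_of_eventuallyConst` (`BakryEmeryLogSobolevReduction.lean`).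

* `bakryEmery_logSobolev_complete_of_heatSemigroup` — **the named fact `bakryEmery_logSobolev_complete`
  from the named fact `weightedHeatSemigroup_strongGradientBound_complete`**: everything specific to
  entropy is thereby proved, and what remains for `bakryEmery_logSobolev_complete_holds` (and for the
  support item `EntropyRung.BakryEmeryLogSobolev` of Summits/SmoothPoincare4) is linear parabolic theory
  on a complete manifold.

Theorems only; no definitions, no named facts.

## References

* [BakryGentilLedoux2014] D. Bakry, I. Gentil, M. Ledoux, *Analysis and Geometry of Markov Diffusion
  Operators*, Springer 2014, Prop. 5.7.1 (p. 268), Thm. 3.2.4 (p. 144). READ (held text).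
* [CarrilloNi2009] J. A. Carrillo, L. Ni, Comm. Anal. Geom. 17 (2009), Thm. 3.1 (p. 7).
* [BakryEmery1985] D. Bakry, M. Émery, LNM 1123 (1985) 177–206.
-/

noncomputable section

open Bundle Set Function Filter Manifold MeasureTheory
open scoped Manifold ContDiff Topology ENNReal NNReal

namespace Literature.Geometry.Riemannian

open Lorentzian Lorentzian.PseudoRiemannianMetric

universe uM

/-! ### One-variable calculus: `H(0) ≤ I₀/2K` from `H' = −I`, `I ≤ e^{-2Kt} I₀`, `H → 0` -/

section Real

/-- **The Bakry–Émery integration**: if `H` is continuous on `[0, ∞)` with `H' = −I` on `(0, ∞)`,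
`I(t) ≤ e^{-2Kt} I₀` (`K > 0`, `I₀ ≥ 0`) and `H(T) → 0` as `T → ∞`, then `H(0) ≤ I₀/(2K)`:
`m(t) = H(t) − (I₀/2K)e^{-2Kt}` is nondecreasing, so `H(0) − I₀/2K ≤ H(T) → 0`.
[cite: BakryGentilLedoux2014, Prop. 5.7.1 (p. 268, proof)] -/
theorem le_div_of_hasDerivAt_of_decay {H I : ℝ → ℝ} {K I₀ : ℝ} (hK : 0 < K) (hI₀ : 0 ≤ I₀)
    (hHc : ContinuousOn H (Ici 0)) (hHd : ∀ t : ℝ, 0 < t → HasDerivAt H (-I t) t)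
    (hI : ∀ t : ℝ, 0 < t → I t ≤ Real.exp (-2 * K * t) * I₀)
    (hlim : Tendsto H atTop (𝓝 0)) : H 0 ≤ 1 / (2 * K) * I₀ := by
  set m : ℝ → ℝ := fun s ↦ H s - I₀ / (2 * K) * Real.exp (-2 * K * s) with hmdef
  have hexpd : ∀ t : ℝ, HasDerivAt (fun s ↦ Real.exp (-2 * K * s))
      (Real.exp (-2 * K * t) * (-2 * K)) t := fun t ↦ by
    have h1 : HasDerivAt (fun s : ℝ ↦ -2 * K * s) (-2 * K) t := by
      simpa using (hasDerivAt_id t).const_mul (-2 * K)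
    exact h1.exp
  have hmc : ContinuousOn m (Ici 0) :=
    hHc.sub (continuousOn_const.mul
      (Real.continuous_exp.comp (continuous_const.mul continuous_id)).continuousOn)
  have hmd : ∀ t ∈ Ioi (0 : ℝ), HasDerivAt m
      (-I t - I₀ / (2 * K) * (Real.exp (-2 * K * t) * (-2 * K))) t := fun t ht ↦
    (hHd t ht).sub ((hexpd t).const_mul _)
  have hmono : MonotoneOn m (Ici 0) := by
    refine monotoneOn_of_deriv_nonneg (convex_Ici 0) hmc ?_ ?_
    · rw [interior_Ici]
      exact fun t ht ↦ (hmd t ht).differentiableAt.differentiableWithinAt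
    · rw [interior_Ici]
      intro t ht
      rw [(hmd t ht).deriv]
      have hdecay := hI t ht
      have hK' : I₀ / (2 * K) * (Real.exp (-2 * K * t) * (-2 * K)) =
          -(Real.exp (-2 * K * t) * I₀) := by
        field_simp
      rw [hK']
      linarith
  have hle : ∀ T : ℝ, 0 ≤ T → H 0 - I₀ / (2 * K) ≤ H T := by
    intro T hT
    have h := hmono (self_mem_Ici (a := (0 : ℝ))) (show T ∈ Ici (0 : ℝ) from hT) hT
    have h0 : m 0 = H 0 - I₀ / (2 * K) := by simp [hmdef]
    have hT' : m T ≤ H T := by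
      have : 0 ≤ I₀ / (2 * K) * Real.exp (-2 * K * T) :=
        mul_nonneg (div_nonneg hI₀ (by linarith)) (Real.exp_pos _).le
      simp only [hmdef]
      linarith
    linarith
  have hev : ∀ᶠ T in atTop, H 0 - I₀ / (2 * K) ≤ H T :=
    eventually_atTop.2 ⟨0, fun T hT ↦ hle T hT⟩
  have hfin := ge_of_tendsto hlim hev
  have : H 0 ≤ I₀ / (2 * K) := by linarith
  calc H 0 ≤ I₀ / (2 * K) := this
    _ = 1 / (2 * K) * I₀ := by ring

end Real

/-! ### The logarithmic Sobolev inequality along the semigroup -/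

section Flow

variable {n : ℕ} {M : Type uM} [TopologicalSpace M] [T2Space M] [SecondCountableTopology M]
  [ChartedSpace (EuclideanSpace ℝ (Fin n)) M] [IsManifold (𝓡 n) ∞ M] [ConnectedSpace M]
  [T3Space M] [MeasurableSpace M] [BorelSpace M]
  {g : PseudoRiemannianMetric (𝓡 n) ∞ (EuclideanSpace ℝ (Fin n)) (TangentSpace (𝓡 n) : M → Type _)}
  [g.HasLeviCivita]

/-- **The Bakry–Émery logarithmic Sobolev inequality for densities constant outside a compact set,
from the heat semigroup** (Bakry–Gentil–Ledoux 2014, Prop. 5.7.1, run on a complete weighted manifold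
for `f = e^φ ∈ 𝒜₀^{const+}`). On a connected complete Riemannian manifold with `∫ e^{-V} dV_g = 1`,
`K > 0`, GIVEN operators `P t` with properties (i)–(iv) of
`weightedHeatSemigroup_strongGradientBound_complete` (Markov, invariance, heat equation for data
constant outside a compact set, strong gradient bound with rate `e^{-Kt}`): for every smooth `φ`
constant outside a compact set with `∫ e^φ e^{-V} dV_g = 1`,
`∫ φ e^φ e^{-V} dV_g ≤ (2K)⁻¹ ∫ |∇φ|² e^φ e^{-V} dV_g`. Proof: along `u(t) = P_t e^φ` (values in
`[e^{-sup|φ|}, e^{sup|φ|}]`, `|Lu| ≤ sup|L e^φ|`, `|∇u(t)|² ≤ e^{-2Kt} sup|∇e^φ|²` by the Markov property),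
`I(t) ≤ e^{-2Kt} I(0)` (`gradSq_div_le_of_strongGradientBound`, invariance), `dH/dt = −I`
(`hasDerivAt_entropy_complete`), `H(t) → 0` (`tendsto_entropy_complete`), hence `H(0) ≤ I(0)/2K`
(`le_div_of_hasDerivAt_of_decay`). [cite: BakryGentilLedoux2014, Prop. 5.7.1 (p. 268)]
[cite: CarrilloNi2009, Thm. 3.1 (p. 7)] -/
theorem logSobolev_eventuallyConst_of_semigroup (hg : g.IsRiemannian)
    (hc : ∀ (x : M) (r : NNReal), IsCompact {y : M | g.edist hg x y ≤ r})
    {V : M → ℝ} (hV : ContMDiff (𝓡 n) 𝓘(ℝ, ℝ) ∞ V) {K : ℝ} (hK : 0 < K)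
    (hmass : ∫ x, Real.exp (-V x) ∂g.riemVolume = 1)
    (P : ℝ → (M → ℝ) → M → ℝ)
    (hPlin : ∀ t : ℝ, 0 ≤ t → ∀ (h₁ h₂ : M → ℝ) (c : ℝ), Continuous h₁ → (∃ C, ∀ x, |h₁ x| ≤ C) →
      Continuous h₂ → (∃ C, ∀ x, |h₂ x| ≤ C) →
      P t (fun x ↦ c * h₁ x + h₂ x) = fun x ↦ c * P t h₁ x + P t h₂ x)
    (hPpos : ∀ t : ℝ, 0 ≤ t → ∀ h : M → ℝ, Continuous h → (∃ C, ∀ x, |h x| ≤ C) →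
      (∀ x, 0 ≤ h x) → ∀ x, 0 ≤ P t h x)
    (hPcont : ∀ t : ℝ, 0 ≤ t → ∀ h : M → ℝ, Continuous h → (∃ C, ∀ x, |h x| ≤ C) → Continuous (P t h))
    (hPone : ∀ t : ℝ, 0 ≤ t → P t (fun _ ↦ (1 : ℝ)) = fun _ ↦ 1)
    (hPinv : ∀ t : ℝ, 0 ≤ t → ∀ h : M → ℝ, Continuous h → (∃ C, ∀ x, |h x| ≤ C) →
      ∫ x, P t h x * Real.exp (-V x) ∂g.riemVolume = ∫ x, h x * Real.exp (-V x) ∂g.riemVolume)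
    (hPflow : ∀ f : M → ℝ, ContMDiff (𝓡 n) 𝓘(ℝ, ℝ) ∞ f →
      (∃ K₀ : Set M, IsCompact K₀ ∧ ∃ c : ℝ, ∀ x, x ∉ K₀ → f x = c) →
      ContMDiffOn ((𝓡 n).prod 𝓘(ℝ, ℝ)) 𝓘(ℝ, ℝ) ∞ (fun p : M × ℝ ↦ P p.2 f p.1) (univ ×ˢ Ici 0) ∧
      P 0 f = f ∧
      (∀ t ∈ Ici (0 : ℝ), ∀ x, derivWithin (fun s ↦ P s f x) (Ici 0) t =
        g.dalembertian (P t f) x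
          - g.innerDual x (mvfderiv (𝓡 n) V x : TangentSpace (𝓡 n) x →ₗ[ℝ] ℝ)
              (mvfderiv (𝓡 n) (P t f) x : TangentSpace (𝓡 n) x →ₗ[ℝ] ℝ)) ∧
      (∀ t ∈ Ici (0 : ℝ), ∀ x, derivWithin (fun s ↦ P s f x) (Ici 0) t =
        P t (fun y ↦ g.dalembertian f y
          - g.innerDual y (mvfderiv (𝓡 n) V y : TangentSpace (𝓡 n) y →ₗ[ℝ] ℝ)
              (mvfderiv (𝓡 n) f y : TangentSpace (𝓡 n) y →ₗ[ℝ] ℝ)) x) ∧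
      (∀ t ∈ Ici (0 : ℝ), ∀ x, Real.sqrt (g.gradSq (P t f) x) ≤
        Real.exp (-K * t) * P t (fun y ↦ Real.sqrt (g.gradSq f y)) x))
    (φ : M → ℝ) (hφ : ContMDiff (𝓡 n) 𝓘(ℝ, ℝ) ∞ φ)
    (hφK : ∃ K₀ : Set M, IsCompact K₀ ∧ ∃ c : ℝ, ∀ x, x ∉ K₀ → φ x = c)
    (hφmass : ∫ x, Real.exp (φ x) * Real.exp (-V x) ∂g.riemVolume = 1) :
    ∫ x, φ x * (Real.exp (φ x) * Real.exp (-V x)) ∂g.riemVolume ≤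
      1 / (2 * K) * ∫ x, g.gradSq φ x * (Real.exp (φ x) * Real.exp (-V x)) ∂g.riemVolume := by
  haveI : Nonempty M := ConnectedSpace.toNonempty
  obtain ⟨o⟩ := ‹Nonempty M›
  obtain ⟨K₀, hK₀, cφ, hcφ⟩ := hφK
  set w : M → ℝ := fun x ↦ Real.exp (-V x) with hwdef
  have hw : Integrable w g.riemVolume := by
    by_contra h'; rw [hwdef, integral_undef h'] at hmass; exact zero_ne_one hmass
  have hw0 : ∀ x, 0 ≤ w x := fun x ↦ (Real.exp_pos _).le
  have hV1 : ContMDiff (𝓡 n) 𝓘(ℝ, ℝ) 1 V := hV.of_le (by norm_num)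
  /- the datum `f = e^φ` and its bounds -/
  set f : M → ℝ := fun x ↦ Real.exp (φ x) with hfdef
  have hf : ContMDiff (𝓡 n) 𝓘(ℝ, ℝ) ∞ f := Real.contDiff_exp.comp_contMDiff hφ
  have hf1 : ContMDiff (𝓡 n) 𝓘(ℝ, ℝ) 1 f := hf.of_le (by norm_num)
  have hf2 : ContMDiff (𝓡 n) 𝓘(ℝ, ℝ) 2 f := hf.of_le (WithTop.coe_le_coe.mpr le_top)
  have hfK : ∃ K₀ : Set M, IsCompact K₀ ∧ ∃ c : ℝ, ∀ x, x ∉ K₀ → f x = c :=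
    ⟨K₀, hK₀, Real.exp cφ, fun x hx ↦ by simp only [hfdef, hcφ x hx]⟩
  obtain ⟨Cφ, hCφ⟩ := exists_forall_abs_le_of_eventuallyConst hφ.continuous ⟨K₀, hK₀, cφ, hcφ⟩
  set a : ℝ := Real.exp (-Cφ) with hadef
  set b : ℝ := Real.exp Cφ with hbdef
  have ha : 0 < a := Real.exp_pos _
  have hfa : ∀ x, a ≤ f x := fun x ↦ Real.exp_le_exp.2 (neg_le_of_abs_le (hCφ x))
  have hfb : ∀ x, f x ≤ b := fun x ↦ Real.exp_le_exp.2 (le_of_abs_le (hCφ x))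
  have hfpos : ∀ x, 0 < f x := fun x ↦ Real.exp_pos _
  have hfbd : ∃ C, ∀ x, |f x| ≤ C := ⟨b, fun x ↦ by rw [abs_of_pos (hfpos x)]; exact hfb x⟩
  -- the gradient of `φ` is continuous and vanishes off `K₀`, hence bounded; `Γ f = f² Γ φ`
  have hΓφc : Continuous (g.gradSq φ) := (contMDiff_gradSq g hφ).continuous
  obtain ⟨CΓφ, hCΓφ⟩ := exists_forall_abs_le_of_eventuallyConst hΓφc ⟨K₀, hK₀, 0, fun x hx ↦
    g.gradSq_eq_zero_of_mvfderiv_eq_zero (mvfderiv_eq_zero_of_eventuallyConst hK₀ hcφ hx)⟩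
  have hΓf : ∀ x, g.gradSq f x = f x ^ 2 * g.gradSq φ x := fun x ↦ by
    have hh : HasDerivAt Real.exp (Real.exp (φ x)) (φ x) := Real.hasDerivAt_exp _
    exact g.gradSq_real_comp hh (hφ.mdifferentiableAt (by simp))
  set CΓf : ℝ := b ^ 2 * CΓφ with hCΓfdef
  have hΓfb : ∀ x, g.gradSq f x ≤ CΓf := fun x ↦ by
    rw [hΓf x]
    exact mul_le_mul (pow_le_pow_left₀ (hfpos x).le (hfb x) 2) ((le_abs_self _).trans (hCΓφ x))
      (g.gradSq_nonneg hg φ x) (sq_nonneg _)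
  have hCΓf0 : 0 ≤ CΓf := (g.gradSq_nonneg hg f o).trans (hΓfb o)
  -- `Lf` is continuous and vanishes off `K₀`, hence bounded
  set Lf : M → ℝ := fun y ↦ g.dalembertian f y
      - g.innerDual y (mvfderiv (𝓡 n) V y : TangentSpace (𝓡 n) y →ₗ[ℝ] ℝ)
          (mvfderiv (𝓡 n) f y : TangentSpace (𝓡 n) y →ₗ[ℝ] ℝ) with hLfdef
  have hLfc : Continuous Lf := (continuous_dalembertian g hf2).sub (continuous_innerDual_mvfderiv g hV1 hf1)
  obtain ⟨CL, hCL⟩ := exists_forall_abs_le_of_eventuallyConst hLfc ⟨K₀, hK₀, 0, fun x hx ↦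
    weightedLaplacian_eq_zero_of_eventuallyConst hf hK₀ (c := Real.exp cφ)
      (fun y hy ↦ by simp only [hfdef, hcφ y hy]) hx⟩
  /- the flow -/
  obtain ⟨hu, hu0, hueq, hueq', hugrad⟩ := hPflow f hf hfK
  set u : ℝ → M → ℝ := fun t ↦ P t f with hudef
  have hab : ∀ t ∈ Ici (0 : ℝ), ∀ x, a ≤ u t x ∧ u t x ≤ b := fun t ht x ↦
    markov_apply_mem_Icc (hPlin t ht) (hPpos t ht) (hPone t ht) hf.continuous hfa hfb x
  have hupos : ∀ t ∈ Ici (0 : ℝ), ∀ x, 0 < u t x := fun t ht x ↦ ha.trans_le (hab t ht x).1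
  have hLu : ∀ t ∈ Ici (0 : ℝ), ∀ x, |g.dalembertian (u t) x
      - g.innerDual x (mvfderiv (𝓡 n) V x : TangentSpace (𝓡 n) x →ₗ[ℝ] ℝ)
          (mvfderiv (𝓡 n) (u t) x : TangentSpace (𝓡 n) x →ₗ[ℝ] ℝ)| ≤ CL := by
    intro t ht x
    have h1 := hueq t ht x
    have h2 := hueq' t ht x
    simp only [hudef]
    rw [← h1, h2]
    have h3 := markov_apply_mem_Icc (hPlin t ht) (hPpos t ht) (hPone t ht) hLfc (fun y ↦ neg_le_of_abs_le (hCL y))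
      (fun y ↦ le_of_abs_le (hCL y)) x
    exact abs_le.2 h3
  have hGu' : ∀ t ∈ Ici (0 : ℝ), ∀ x, g.gradSq (u t) x ≤ (Real.exp (-K * t)) ^ 2 * CΓf := by
    intro t ht x
    have h1 := hugrad t ht x
    have h2 : P t (fun y ↦ Real.sqrt (g.gradSq f y)) x ≤ Real.sqrt CΓf :=
      (markov_apply_mem_Icc (hPlin t ht) (hPpos t ht) (hPone t ht) (contMDiff_gradSq g hf).continuous.sqrt (fun y ↦ Real.sqrt_nonneg _)
        (fun y ↦ Real.sqrt_le_sqrt (hΓfb y)) x).2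
    have h3 : Real.sqrt (g.gradSq (u t) x) ≤ Real.exp (-K * t) * Real.sqrt CΓf :=
      h1.trans (mul_le_mul_of_nonneg_left h2 (Real.exp_pos _).le)
    have h4 := pow_le_pow_left₀ (Real.sqrt_nonneg _) h3 2
    rwa [Real.sq_sqrt (g.gradSq_nonneg hg _ x), mul_pow, Real.sq_sqrt hCΓf0] at h4
  have hGu : ∀ t ∈ Ici (0 : ℝ), ∀ x, g.gradSq (u t) x ≤ CΓf := by
    intro t ht x
    refine (hGu' t ht x).trans (mul_le_of_le_one_left hCΓf0 ?_)
    have h1 : Real.exp (-K * t) ≤ 1 := Real.exp_le_one_iff.2 (by nlinarith [mem_Ici.1 ht])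
    exact pow_le_one₀ (Real.exp_pos _).le h1
  have hmassu : ∀ t ∈ Ici (0 : ℝ), ∫ x, u t x * Real.exp (-V x) ∂g.riemVolume = 1 := by
    intro t ht
    simp only [hudef]
    rw [hPinv t ht f hf.continuous hfbd]
    exact hφmass
  have huc1 : ∀ t ∈ Ici (0 : ℝ), ContMDiff (𝓡 n) 𝓘(ℝ, ℝ) 1 (u t) := fun t ht ↦
    (hu.comp_contMDiff (contMDiff_id.prodMk contMDiff_const) fun y ↦ ⟨mem_univ _, ht⟩).of_le
      (by norm_num)
  /- the entropy and the Fisher information along the flow -/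
  set Hf : ℝ → ℝ := fun s ↦ ∫ x, u s x * Real.log (u s x) * Real.exp (-V x) ∂g.riemVolume with hHfdef
  set If : ℝ → ℝ := fun s ↦ ∫ x, g.gradSq (u s) x / u s x * Real.exp (-V x) ∂g.riemVolume with hIfdef
  -- `I(t) ≤ e^{-2Kt} I(0)`
  have hQc : Continuous (fun y ↦ g.gradSq f y / f y) :=
    (contMDiff_gradSq g hf).continuous.div hf.continuous fun y ↦ (hfpos y).ne'
  have hQb : ∃ C, ∀ y, |g.gradSq f y / f y| ≤ C := ⟨CΓf / a, fun y ↦ by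
    rw [abs_of_nonneg (div_nonneg (g.gradSq_nonneg hg f y) (hfpos y).le)]
    exact div_le_div₀ hCΓf0 (hΓfb y) ha (hfa y)⟩
  have hI : ∀ t : ℝ, 0 < t → If t ≤ Real.exp (-2 * K * t) * If 0 := by
    intro t ht
    have ht' : t ∈ Ici (0 : ℝ) := le_of_lt ht
    have hpt : ∀ x, g.gradSq (u t) x / u t x ≤
        Real.exp (-K * t) ^ 2 * P t (fun y ↦ g.gradSq f y / f y) x := fun x ↦
      gradSq_div_le_of_strongGradientBound hg (hPlin t ht') (hPpos t ht') (hPone t ht') hf hfbd ⟨CΓf, hΓfb⟩ ha hfa rfl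
        (hugrad t ht') x
    have h := integral_gradSq_div_le hg (hPlin t ht') (hPpos t ht') (hPone t ht') hf ⟨CΓf, hΓfb⟩ ha hfa (hupos t ht') hw0 hw hpt
      (hPcont t ht' _ hQc hQb) (hPinv t ht' _ hQc hQb)
    have hexp : Real.exp (-K * t) ^ 2 = Real.exp (-2 * K * t) := by
      rw [sq, ← Real.exp_add]; ring_nf
    have hI0 : If 0 = ∫ x, g.gradSq f x / f x * Real.exp (-V x) ∂g.riemVolume := by
      simp only [hIfdef, hudef, hu0]
    rw [hI0, ← hexp]
    exact h
  -- `dH/dt = −I`, `H` continuous, `H → 0`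
  have hHd : ∀ t : ℝ, 0 < t → HasDerivAt Hf (-If t) t := fun t ht ↦
    hasDerivAt_entropy_complete hg hc hV hw hu hueq ha hab hLu hGu ht
  have hHc : ContinuousOn Hf (Ici 0) := continuousOn_entropy_complete hV hw hu ha hab
  have hlim : Tendsto Hf atTop (𝓝 0) :=
    tendsto_entropy_complete hg hV hw hmass huc1 ha hab hK hCΓf0 hGu' hmassu
  have hI₀ : 0 ≤ If 0 := integral_nonneg fun x ↦
    mul_nonneg (div_nonneg (g.gradSq_nonneg hg _ x) (hupos 0 self_mem_Ici x).le) (hw0 x)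
  have hmain := le_div_of_hasDerivAt_of_decay hK hI₀ hHc hHd hI hlim
  /- identification of `H(0)` and `I(0)` -/
  have hH0 : Hf 0 = ∫ x, φ x * (Real.exp (φ x) * Real.exp (-V x)) ∂g.riemVolume := by
    simp only [hHfdef, hudef, hu0]
    refine integral_congr_ae (Eventually.of_forall fun x ↦ ?_)
    simp only [hfdef, Real.log_exp]
    ring
  have hI0 : If 0 = ∫ x, g.gradSq φ x * (Real.exp (φ x) * Real.exp (-V x)) ∂g.riemVolume := by
    simp only [hIfdef, hudef, hu0]
    refine integral_congr_ae (Eventually.of_forall fun x ↦ ?_)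
    dsimp only
    rw [hΓf x]
    simp only [hfdef]
    have hne : Real.exp (φ x) ≠ 0 := (Real.exp_pos _).ne'
    field_simp
  rw [hH0, hI0] at hmain
  exact hmain

end Flow

/-! ### The named fact from the heat semigroup -/

/-- **`bakryEmery_logSobolev_complete` follows from the heat semigroup of the complete weighted
manifold with its strong gradient bound** (`weightedHeatSemigroup_strongGradientBound_complete`,
Bakry–Gentil–Ledoux 2014, Thm. 3.2.4 + Thm. 3.2.6): the density step
`bakryEmery_logSobolev_complete_of_eventuallyConst` (`BakryEmeryLogSobolevReduction.lean`) reduces the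
fact to smooth `φ` constant outside a compact set, where it is `logSobolev_eventuallyConst_of_semigroup`
(the Bakry–Émery argument above). So the logarithmic Sobolev inequality of a complete
`CD(K, ∞)` weighted manifold — and with it the support item `EntropyRung.BakryEmeryLogSobolev` of
Summits/SmoothPoincare4 — is reduced to the existence and the `Γ`-commutation of the heat semigroup,
a piece of linear parabolic theory with no reference to entropy.
[cite: BakryGentilLedoux2014, Prop. 5.7.1 (p. 268) and Thm. 3.2.4 (p. 144)] [cite: CarrilloNi2009, Thm. 3.1 (p. 7)] -/
theorem bakryEmery_logSobolev_complete_of_heatSemigroup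
    (h : weightedHeatSemigroup_strongGradientBound_complete) : bakryEmery_logSobolev_complete := by
  refine bakryEmery_logSobolev_complete_of_eventuallyConst ?_
  intro n M _ _ _ _ _ _ _ _ _ g _ V K hg hc hV hK hRic hmass φ hφ hφK hφmass
  have hc' : ∀ (x : M) (r : NNReal), IsCompact {y : M | g.edist hg x y ≤ r} := fun x r ↦ by
    simpa only [PseudoRiemannianMetric.riemEDist_eq hg] using hc x r
  have hwI : Integrable (fun x ↦ Real.exp (-V x)) g.riemVolume := by
    by_contra h'; rw [integral_undef h'] at hmass; exact zero_ne_one hmass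
  obtain ⟨P, hPlin, hPpos, hPcont, hPone, hPinv, hPflow⟩ := h n M g V K hg hc hV hRic hwI
  exact logSobolev_eventuallyConst_of_semigroup hg hc' hV hK hmass P hPlin hPpos hPcont hPone hPinv
    hPflow φ hφ hφK hφmass

end Literature.Geometry.Riemannian

end
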